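import Mathlib
import Summits.Ventures.PercRepro2.KPrimeReduction
import Summits.Ventures.PercRepro2.KPrimeSure

/-!
# The tensor-Bernstein expansion of the `(K′)` form and the conjecture `(TB)`
(blind cell PercRepro2, mine-c g42; `conjectures/MINE-C.md` §51.0)

Each mass of the cleared form `kprimeForm` is `∑ ω, 1_A(ω) · weight p ω`, and the weight of a
configuration is the degree-`1` Bernstein basis element `∏ e, p e^{ω e} (1 − p e)^{1 − ω e}`.  A
product of three masses is therefore a triple sum over configurations, and the product of the
three weights is the degree-`3` basis element `bernBasis p s = ∏ e, p e^{s e} (1 − p e)^{3 − s e}`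
at the coordinate sum `s = cfgSum ω₁ ω₂ ω₃ ∈ {0,1,2,3}^E` (`weight_mul_weight_mul_weight`).  Grouping
the six signed triple products of `kprimeForm` by `s` gives the **tensor-Bernstein expansion**

  `kprimeForm(p) = ∑ s : E → Fin 4, tbCoeff s · bernBasis p s`   (`kprimeForm_eq_sum_tb`),

with the WEIGHT-FREE coefficients `tbCoeff s = ∑_{ω₁+ω₂+ω₃ = s} tbSign ω₁ ω₂ ω₃` (a signed count of
triples of configurations).  Since every `bernBasis p s ≥ 0` on `[0,1]^E`, the conjecture

  **(TB)**: `0 ≤ tbCoeff s` for every `s`   (`TBHolds`)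

implies `(K′)` for every admissible weight vector (`kprime_of_tb`).  `(TB)` is the Reimer form of
the lemma of record (the same construction turns BK into Reimer's `|𝒜 ∩ ℬ̄| ≥ |𝒜 □ ℬ|`); it holds
on every marked graph of the census of `MINE-C.md` §51.0 (all graphs on ≤ 6 vertices with ≤ 13
edges, random graphs on 7 and 8 vertices, multigraphs, coincident marks — 0 negative coefficients
in 106,197 instances).  It is not proved here.
-/

namespace Summit.Ventures.PercRepro2

namespace KPrime

variable {V : Type*} {E : Type*} [Fintype E] [DecidableEq E] [DecidableEq V]
  {R : Type*} [Field R] [LinearOrder R] [IsStrictOrderedRing R]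

/-! ## The degree-3 tensor-Bernstein basis -/

section Basis

/-- The coordinate sum of three configurations, `s e = ω₁ e + ω₂ e + ω₃ e ∈ {0, 1, 2, 3}`. -/
def cfgSum (ω₁ ω₂ ω₃ : Config E) : E → Fin 4 := fun e =>
  ⟨(ω₁ e).toNat + (ω₂ e).toNat + (ω₃ e).toNat, by
    cases ω₁ e <;> cases ω₂ e <;> cases ω₃ e <;> simp⟩

omit [Fintype E] [DecidableEq E] in
/-- The value of `cfgSum`. -/
lemma cfgSum_val (ω₁ ω₂ ω₃ : Config E) (e : E) :
    ((cfgSum ω₁ ω₂ ω₃ e : Fin 4) : ℕ) = (ω₁ e).toNat + (ω₂ e).toNat + (ω₃ e).toNat := rfl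

/-- The degree-`3` tensor-Bernstein basis element `∏ e, p e^{s e} (1 − p e)^{3 − s e}`. -/
def bernBasis (p : E → R) (s : E → Fin 4) : R :=
  ∏ e, p e ^ (s e : ℕ) * (1 - p e) ^ (3 - (s e : ℕ))

omit [DecidableEq E] in
/-- The basis elements are non-negative on `[0, 1]^E`. -/
lemma bernBasis_nonneg {p : E → R} (hp : IsProbVec p) (s : E → Fin 4) : 0 ≤ bernBasis p s :=
  Finset.prod_nonneg fun e _ =>
    mul_nonneg (pow_nonneg (hp.nonneg e) _) (pow_nonneg (sub_nonneg.2 (hp.le_one e)) _)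

omit [DecidableEq E] [LinearOrder R] [IsStrictOrderedRing R] in
/-- **Three weights multiply to a basis element**: `weight p ω₁ · weight p ω₂ · weight p ω₃ =
bernBasis p (cfgSum ω₁ ω₂ ω₃)`. -/
lemma weight_mul_weight_mul_weight (p : E → R) (ω₁ ω₂ ω₃ : Config E) :
    weight p ω₁ * weight p ω₂ * weight p ω₃ = bernBasis p (cfgSum ω₁ ω₂ ω₃) := by
  unfold weight bernBasis
  rw [← Finset.prod_mul_distrib, ← Finset.prod_mul_distrib]
  refine Finset.prod_congr rfl fun e _ => ?_
  rw [cfgSum_val]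
  cases ω₁ e <;> cases ω₂ e <;> cases ω₃ e <;>
    simp only [edgeFactor_true, edgeFactor_false, Bool.toNat_true, Bool.toNat_false, Nat.reduceAdd,
      Nat.reduceSub, Nat.add_zero, Nat.zero_add, Nat.sub_zero, Nat.sub_self, pow_zero, pow_one,
      mul_one, one_mul] <;> ring

end Basis

/-! ## Triple expectations -/

section Triple

/-- The indicator of an event as a function to `R`. -/
noncomputable def ind (A : Set (Config E)) (ω : Config E) : R :=
  by classical exact if ω ∈ A then 1 else 0

omit [LinearOrder R] [IsStrictOrderedRing R] in
/-- A mass is the sum of the indicator times the weight. -/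
lemma prob_eq_sum_ind (p : E → R) (A : Set (Config E)) :
    prob p A = ∑ ω, ind A ω * weight p ω := by
  classical
  unfold prob ind
  refine Finset.sum_congr rfl fun ω _ => ?_
  simp only [Set.indicator_apply]
  split_ifs <;> simp

/-- The triple expectation: `∑ ω₁ ω₂ ω₃, f ω₁ ω₂ ω₃ · weight p ω₁ · weight p ω₂ · weight p ω₃`. -/
noncomputable def expect3 (p : E → R) (f : Config E → Config E → Config E → R) : R :=
  ∑ ω₁, ∑ ω₂, ∑ ω₃, f ω₁ ω₂ ω₃ * (weight p ω₁ * weight p ω₂ * weight p ω₃)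

omit [LinearOrder R] [IsStrictOrderedRing R] in
/-- A product of three masses is the triple expectation of the product of indicators. -/
lemma prob_mul_prob_mul_prob (p : E → R) (A B C : Set (Config E)) :
    prob p A * prob p B * prob p C =
      expect3 p fun ω₁ ω₂ ω₃ => ind A ω₁ * ind B ω₂ * ind C ω₃ := by
  unfold expect3
  rw [prob_eq_sum_ind, prob_eq_sum_ind, prob_eq_sum_ind, Finset.sum_mul_sum, Finset.sum_mul_sum]
  simp only [Finset.sum_mul]
  refine Finset.sum_congr rfl fun ω₁ _ => ?_
  rw [Finset.sum_comm]
  refine Finset.sum_congr rfl fun ω₂ _ => Finset.sum_congr rfl fun ω₃ _ => ?_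
  ring

omit [LinearOrder R] [IsStrictOrderedRing R] in
/-- Linearity of the triple expectation. -/
lemma expect3_add (p : E → R) (f g : Config E → Config E → Config E → R) :
    expect3 p (fun ω₁ ω₂ ω₃ => f ω₁ ω₂ ω₃ + g ω₁ ω₂ ω₃) = expect3 p f + expect3 p g := by
  unfold expect3
  simp only [add_mul, Finset.sum_add_distrib]

omit [LinearOrder R] [IsStrictOrderedRing R] in
/-- Linearity of the triple expectation. -/
lemma expect3_sub (p : E → R) (f g : Config E → Config E → Config E → R) :
    expect3 p (fun ω₁ ω₂ ω₃ => f ω₁ ω₂ ω₃ - g ω₁ ω₂ ω₃) = expect3 p f - expect3 p g := by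
  unfold expect3
  simp only [sub_mul, Finset.sum_sub_distrib]

omit [LinearOrder R] [IsStrictOrderedRing R] in
/-- **Grouping by the coordinate sum**: a triple expectation is a sum over `s ∈ {0,1,2,3}^E` of
the fibre sums times the basis elements. -/
lemma expect3_eq_sum_fiber (p : E → R) (f : Config E → Config E → Config E → R) :
    expect3 p f = ∑ s : E → Fin 4,
      (∑ t ∈ (Finset.univ : Finset (Config E × Config E × Config E)).filter
        (fun t => cfgSum t.1 t.2.1 t.2.2 = s), f t.1 t.2.1 t.2.2) * bernBasis p s := by
  symm
  calc ∑ s : E → Fin 4, (∑ t ∈ (Finset.univ : Finset (Config E × Config E × Config E)).filter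
          (fun t => cfgSum t.1 t.2.1 t.2.2 = s), f t.1 t.2.1 t.2.2) * bernBasis p s
      = ∑ s : E → Fin 4, ∑ t ∈ (Finset.univ : Finset (Config E × Config E × Config E)).filter
          (fun t => cfgSum t.1 t.2.1 t.2.2 = s),
            f t.1 t.2.1 t.2.2 * bernBasis p (cfgSum t.1 t.2.1 t.2.2) := by
        refine Finset.sum_congr rfl fun s _ => ?_
        rw [Finset.sum_mul]
        refine Finset.sum_congr rfl fun t ht => ?_
        rw [(Finset.mem_filter.1 ht).2]
    _ = ∑ t : Config E × Config E × Config E,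
          f t.1 t.2.1 t.2.2 * bernBasis p (cfgSum t.1 t.2.1 t.2.2) :=
        Finset.sum_fiberwise _ _ _
    _ = expect3 p f := by
        unfold expect3
        rw [Fintype.sum_prod_type]
        refine Finset.sum_congr rfl fun ω₁ _ => ?_
        rw [Fintype.sum_prod_type]
        refine Finset.sum_congr rfl fun ω₂ _ => Finset.sum_congr rfl fun ω₃ _ => ?_
        rw [weight_mul_weight_mul_weight]

end Triple

/-! ## The expansion of `kprimeForm` -/

section Expansion

variable (ends : E → Sym2 V) (a₁ a₂ b v y : V)

/-- The signed indicator of the six triple products of `kprimeForm` at a triple of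
configurations: `+[U∩X∩Ω][N][Y∩S] − [X∩N][U∩Ω][Y∩S] + [S][(0,1)ᵉ][N] − [S][X∩N][(0,1)]
− [S][U∩Y∩X∩Ω][N] + [S][X∩N][U∩Y∩Ω]`. -/
noncomputable def tbSign (ω₁ ω₂ ω₃ : Config E) : R :=
  ind (connEvent ends a₁ v ∩ connEvent ends a₁ b ∩ Ω ends a₁ a₂) ω₁ * ind (N ends a₁ a₂ v) ω₂ *
      ind (connEvent ends a₂ y ∩ S ends a₁ a₂ v) ω₃ -
    ind (connEvent ends a₁ b ∩ N ends a₁ a₂ v) ω₁ * ind (connEvent ends a₁ v ∩ Ω ends a₁ a₂) ω₂ *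
      ind (connEvent ends a₂ y ∩ S ends a₁ a₂ v) ω₃ +
    ind (S ends a₁ a₂ v) ω₁ * ind (cls01e ends a₁ a₂ b v y) ω₂ * ind (N ends a₁ a₂ v) ω₃ -
    ind (S ends a₁ a₂ v) ω₁ * ind (connEvent ends a₁ b ∩ N ends a₁ a₂ v) ω₂ *
      ind (cls01 ends a₁ a₂ v y) ω₃ -
    ind (S ends a₁ a₂ v) ω₁ *
      ind (connEvent ends a₁ v ∩ connEvent ends a₂ y ∩ connEvent ends a₁ b ∩ Ω ends a₁ a₂) ω₂ *
      ind (N ends a₁ a₂ v) ω₃ +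
    ind (S ends a₁ a₂ v) ω₁ * ind (connEvent ends a₁ b ∩ N ends a₁ a₂ v) ω₂ *
      ind (connEvent ends a₁ v ∩ connEvent ends a₂ y ∩ Ω ends a₁ a₂) ω₃

/-- **The tensor-Bernstein coefficient** `c_s`: the signed count of the triples of configurations
with coordinate sum `s` (weight-free: it depends on the graph and the marks only). -/
noncomputable def tbCoeff (s : E → Fin 4) : R :=
  ∑ t ∈ (Finset.univ : Finset (Config E × Config E × Config E)).filter
    (fun t => cfgSum t.1 t.2.1 t.2.2 = s), tbSign ends a₁ a₂ b v y t.1 t.2.1 t.2.2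

omit [LinearOrder R] [IsStrictOrderedRing R] in
/-- The cleared form is the triple expectation of `tbSign`. -/
lemma kprimeForm_eq_expect3 (p : E → R) :
    kprimeForm ends a₁ a₂ b v y p (prob p (connEvent ends a₁ b ∩ N ends a₁ a₂ v))
        (prob p (N ends a₁ a₂ v)) =
      expect3 p (tbSign ends a₁ a₂ b v y) := by
  have h : kprimeForm ends a₁ a₂ b v y p (prob p (connEvent ends a₁ b ∩ N ends a₁ a₂ v))
      (prob p (N ends a₁ a₂ v)) =
      prob p (connEvent ends a₁ v ∩ connEvent ends a₁ b ∩ Ω ends a₁ a₂) * prob p (N ends a₁ a₂ v) *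
          prob p (connEvent ends a₂ y ∩ S ends a₁ a₂ v) -
        prob p (connEvent ends a₁ b ∩ N ends a₁ a₂ v) * prob p (connEvent ends a₁ v ∩ Ω ends a₁ a₂) *
          prob p (connEvent ends a₂ y ∩ S ends a₁ a₂ v) +
        prob p (S ends a₁ a₂ v) * prob p (cls01e ends a₁ a₂ b v y) * prob p (N ends a₁ a₂ v) -
        prob p (S ends a₁ a₂ v) * prob p (connEvent ends a₁ b ∩ N ends a₁ a₂ v) *
          prob p (cls01 ends a₁ a₂ v y) -
        prob p (S ends a₁ a₂ v) *
          prob p (connEvent ends a₁ v ∩ connEvent ends a₂ y ∩ connEvent ends a₁ b ∩ Ω ends a₁ a₂) *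
          prob p (N ends a₁ a₂ v) +
        prob p (S ends a₁ a₂ v) * prob p (connEvent ends a₁ b ∩ N ends a₁ a₂ v) *
          prob p (connEvent ends a₁ v ∩ connEvent ends a₂ y ∩ Ω ends a₁ a₂) := by
    unfold kprimeForm; ring
  rw [h]
  simp only [prob_mul_prob_mul_prob]
  unfold tbSign
  simp only [expect3_add, expect3_sub]

omit [LinearOrder R] [IsStrictOrderedRing R] in
/-- **The tensor-Bernstein expansion of the `(K′)` form.** -/
theorem kprimeForm_eq_sum_tb (p : E → R) :
    kprimeForm ends a₁ a₂ b v y p (prob p (connEvent ends a₁ b ∩ N ends a₁ a₂ v))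
        (prob p (N ends a₁ a₂ v)) =
      ∑ s : E → Fin 4, tbCoeff ends a₁ a₂ b v y s * bernBasis p s := by
  rw [kprimeForm_eq_expect3, expect3_eq_sum_fiber]
  rfl

/-- **The conjecture (TB)**: every tensor-Bernstein coefficient of the `(K′)` form is
non-negative (`MINE-C.md` §51.0). -/
def TBHolds : Prop := ∀ s : E → Fin 4, 0 ≤ tbCoeff (R := R) ends a₁ a₂ b v y s

/-- **(TB) implies (K′)** for every admissible weight vector. -/
theorem kprime_of_tb (h : TBHolds (R := R) ends a₁ a₂ b v y) (p : E → R) (hp : IsProbVec p) :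
    KPrimeHolds ends a₁ a₂ b v y p := by
  unfold KPrimeHolds
  rw [kprimeForm_eq_sum_tb]
  exact Finset.sum_nonneg fun s _ => mul_nonneg (h s) (bernBasis_nonneg hp s)

end Expansion

end KPrime

end Summit.Ventures.PercRepro2
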